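import Mathlib

/-!
# The V₄ Jordan block has order `p` (first Lean rung of `JordanBlockFourfold`, stmt-ResolutionOfSingularities-17942)

(crux stmt-ResolutionOfSingularities-15640 `WildQuotients.WildQuotientResolution`, line `Sketch`; stub
`jordanBlock_order` registered by lead res-L1-w45c-lead-1; [OURS · L1 W4.5c] — NOT a statement of any
manuscript.)

For the `k`-algebra automorphism `σ` of `k[x₀,x₁,x₂,x₃]` with `σ x₀ = x₀`, `σ x₁ = x₁ + x₀`,
`σ x₂ = x₂ + x₁`, `σ x₃ = x₃ + x₂` over a field of characteristic `p ≥ 5`: the iterates are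
`σⁿ x₃ = x₃ + n x₂ + C(n,2) x₁ + C(n,3) x₀` (and truncations for `x₂, x₁, x₀`;
`jordanBlock_pow_apply_X`), so `σ ^ p = 1` because `p ∣ C(p,j)` for `1 ≤ j ≤ 3 < p`; `σ ≠ 1`
(`σ x₁ ≠ x₁`); hence `σ` has order `p` and the cyclic group `Subgroup.zpowers σ` — the group of item
17942, acting on `𝔸⁴` with quotient `𝔸⁴/V₄` — has exactly `p` elements (`jordanBlock_order`).
-/

-- single-problem summit: the doubled namespace component `ResolutionOfSingularities` is forced
set_option linter.dupNamespace false

noncomputable section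

open MvPolynomial

namespace Summit.ResolutionOfSingularities.ResolutionOfSingularities.Theorems.WildQuotientResolution.JordanBlock

/-- **Iterates of the unipotent Jordan block on the coordinates.** For a `k`-algebra automorphism
`σ` of `k[x₀,…,x₃]` with `σ x₀ = x₀`, `σ xᵢ = xᵢ + xᵢ₋₁` (`i = 1, 2, 3`) and every `n`:
`σⁿ x₀ = x₀`, `σⁿ x₁ = x₁ + n x₀`, `σⁿ x₂ = x₂ + n x₁ + C(n,2) x₀`,
`σⁿ x₃ = x₃ + n x₂ + C(n,2) x₁ + C(n,3) x₀` (induction on `n`, Pascal's rule). [folklore] -/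
theorem jordanBlock_pow_apply_X (k : Type) [Field k]
    (σ : MvPolynomial (Fin 4) k ≃ₐ[k] MvPolynomial (Fin 4) k)
    (h0 : σ (MvPolynomial.X 0) = MvPolynomial.X 0)
    (h1 : σ (MvPolynomial.X 1) = MvPolynomial.X 1 + MvPolynomial.X 0)
    (h2 : σ (MvPolynomial.X 2) = MvPolynomial.X 2 + MvPolynomial.X 1)
    (h3 : σ (MvPolynomial.X 3) = MvPolynomial.X 3 + MvPolynomial.X 2) (n : ℕ) :
    (σ ^ n) (X 0) = X 0 ∧
    (σ ^ n) (X 1) = X 1 + (n : MvPolynomial (Fin 4) k) * X 0 ∧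
    (σ ^ n) (X 2) = X 2 + (n : MvPolynomial (Fin 4) k) * X 1 +
      (n.choose 2 : MvPolynomial (Fin 4) k) * X 0 ∧
    (σ ^ n) (X 3) = X 3 + (n : MvPolynomial (Fin 4) k) * X 2 +
      (n.choose 2 : MvPolynomial (Fin 4) k) * X 1 + (n.choose 3 : MvPolynomial (Fin 4) k) * X 0 := by
  induction n with
  | zero =>
    refine ⟨?_, ?_, ?_, ?_⟩ <;> simp [Nat.choose_zero_succ]
  | succ n ih =>
    obtain ⟨e0, e1, e2, e3⟩ := ih
    have c2 : ((n + 1).choose 2 : ℕ) = n + n.choose 2 := by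
      simpa using Nat.choose_succ_succ' n 1
    have c3 : ((n + 1).choose 3 : ℕ) = n.choose 2 + n.choose 3 := by
      simpa using Nat.choose_succ_succ' n 2
    refine ⟨?_, ?_, ?_, ?_⟩
    · rw [pow_succ', AlgEquiv.mul_apply, e0, h0]
    · rw [pow_succ', AlgEquiv.mul_apply, e1, map_add, map_mul, map_natCast, h0, h1]
      push_cast
      ring
    · rw [pow_succ', AlgEquiv.mul_apply, e2, map_add, map_add, map_mul, map_mul, map_natCast,
        map_natCast, h0, h1, h2, c2]
      push_cast
      ring
    · rw [pow_succ', AlgEquiv.mul_apply, e3, map_add, map_add, map_add, map_mul, map_mul, map_mul,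
        map_natCast, map_natCast, map_natCast, h0, h1, h2, h3, c2, c3]
      push_cast
      ring

/-- STUB `jordanBlock_order` (M, classical): the unipotent `4 × 4` Jordan block `σ` on `k[x₀,…,x₃]`
(`σ xᵢ = xᵢ + xᵢ₋₁`) over a field of characteristic `p ≥ 5` satisfies `σ ^ p = 1` (because
`σⁿ x₃ = x₃ + n x₂ + C(n,2) x₁ + C(n,3) x₀` and `p` divides `C(p,j)` for `1 ≤ j ≤ 3 < p`), `σ ≠ 1`, and
`Subgroup.zpowers σ` has exactly `p` elements (the order of `σ` divides the prime `p` and is not `1`).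
[folklore] -/
theorem jordanBlock_order (p : ℕ) (hp : p.Prime) (hp5 : 5 ≤ p) (k : Type) [Field k] [CharP k p]
    (σ : MvPolynomial (Fin 4) k ≃ₐ[k] MvPolynomial (Fin 4) k)
    (h0 : σ (MvPolynomial.X 0) = MvPolynomial.X 0)
    (h1 : σ (MvPolynomial.X 1) = MvPolynomial.X 1 + MvPolynomial.X 0)
    (h2 : σ (MvPolynomial.X 2) = MvPolynomial.X 2 + MvPolynomial.X 1)
    (h3 : σ (MvPolynomial.X 3) = MvPolynomial.X 3 + MvPolynomial.X 2) :
    σ ^ p = 1 ∧ σ ≠ 1 ∧ Nat.card (Subgroup.zpowers σ) = p := by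
  classical
  haveI : Fact p.Prime := ⟨hp⟩
  obtain ⟨e0, e1, e2, e3⟩ := jordanBlock_pow_apply_X k σ h0 h1 h2 h3 p
  -- `p`, `C(p,2)`, `C(p,3)` vanish in characteristic `p ≥ 5`
  have hp0 : (p : MvPolynomial (Fin 4) k) = 0 := CharP.cast_eq_zero _ p
  have hc2 : ((p.choose 2 : ℕ) : MvPolynomial (Fin 4) k) = 0 :=
    (CharP.cast_eq_zero_iff (MvPolynomial (Fin 4) k) p _).mpr
      (hp.dvd_choose_self (by norm_num) (by omega))
  have hc3 : ((p.choose 3 : ℕ) : MvPolynomial (Fin 4) k) = 0 :=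
    (CharP.cast_eq_zero_iff (MvPolynomial (Fin 4) k) p _).mpr
      (hp.dvd_choose_self (by norm_num) (by omega))
  rw [hp0] at e1 e2 e3
  rw [hc2] at e2 e3
  rw [hc3] at e3
  simp only [zero_mul, add_zero] at e1 e2 e3
  -- `σ ^ p = 1`: check on the generators
  have hpow : σ ^ p = 1 := by
    have key : ((σ ^ p : MvPolynomial (Fin 4) k ≃ₐ[k] MvPolynomial (Fin 4) k) :
        MvPolynomial (Fin 4) k →ₐ[k] MvPolynomial (Fin 4) k) = AlgHom.id k _ := by
      refine MvPolynomial.algHom_ext fun i => ?_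
      change (σ ^ p) (X i) = X i
      match i with
      | 0 => exact e0
      | 1 => exact e1
      | 2 => exact e2
      | 3 => exact e3
    apply AlgEquiv.ext
    intro a
    have := DFunLike.congr_fun key a
    simpa using this
  -- `σ ≠ 1`: `σ x₁ = x₁ + x₀ ≠ x₁`
  have hne : σ ≠ 1 := by
    intro h
    have h1' := h1
    rw [h, AlgEquiv.one_apply] at h1'
    have hX0 : (X 0 : MvPolynomial (Fin 4) k) = 0 := by
      have := congrArg (fun f => f - X 1) h1'
      simp only [sub_self, add_sub_cancel_left] at this
      exact this.symm
    exact MvPolynomial.X_ne_zero _ hX0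
  refine ⟨hpow, hne, ?_⟩
  rw [Nat.card_zpowers, orderOf_eq_prime hpow hne]

end Summit.ResolutionOfSingularities.ResolutionOfSingularities.Theorems.WildQuotientResolution.JordanBlock

end
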